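import Literature.NumberTheory.GaloisRepresentations.SorensenPatchingHypotheses
import Literature.RepresentationTheory.Semisimple.SubrepresentationEquiv
import HarnessLib

/-!
# Irreducibility of `ρ|_{Γ_L}` versus `(ρ|_{Γ_E})|_{Γ_L}` along a tower `F ⊆ E ⊆ L`

Tower step of the solvable base-change ascent for crux stmt-Langlands-14329
(`Summit.Langlands.Langlands.Theses.IrreducibilityBySelfDuality.IrreducibleOffSector`, line Sketch,
lead package "BC-ascent", stub W11).  Irreducibility of a Galois representation
`ρ : Γ_F → GL_n(k)` ascends along a cyclic extension of degree prime to `n` (Clifford theory); to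
extend this to a *solvable* Galois extension `L/F` one inducts along a tower `F ⊆ E ⊆ L` of cyclic
steps, obtaining irreducibility of `(ρ|_{Γ_E})|_{Γ_L}`, and must then transport the conclusion to
`ρ|_{Γ_L}`.  The two restrictions are *not* literally equal (each restriction map between absolute
Galois groups is defined through its own choice of embedding of algebraic closures), but they differ
by an inner automorphism of `Γ_F`, whence an equivalence of continuous representations
(`SorensenPatching.nonempty_equiv_restrictField_restrictField`, Milne, *Fields and Galois Theory*,
Ch. 7).  Irreducibility is invariant under equivalence
(`Literature.RepresentationTheory.Semisimple.Representation.isIrreducible_of_equiv`), which gives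

* `ContinuousRep.isIrreducible_iff_of_equiv` — `ρ₁ ≃ ρ₂ → (ρ₁ irreducible ↔ ρ₂ irreducible)`;
* `isIrreducible_restrictField_restrictField_iff` —
  `(ρ|_{Γ_E})|_{Γ_L}` is irreducible iff `ρ|_{Γ_L}` is.

No new definitions; axioms `propext`, `Classical.choice`, `Quot.sound`.
-/

noncomputable section

-- `Summit.Langlands.Langlands.…` (summit = sub-problem name, D-0017 layout) trips `dupNamespace`
set_option linter.dupNamespace false

open Literature.NumberTheory.GaloisRepresentations Field

namespace Summit.Langlands.Langlands.Theorems.IrreducibleOffSector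

/-- **Irreducibility is invariant under equivalence of continuous representations** (field
coefficients): an equivalence `e : ρ₁ ≃ ρ₂` is in particular an equivalence of the underlying
algebraic representations (Mathlib `Representation.Equiv`), and irreducibility — simplicity of the
lattice of subrepresentations — is transported along it and along `e.symm`. [folklore] -/
theorem ContinuousRep.isIrreducible_iff_of_equiv {G : Type*} [Group G] [TopologicalSpace G]
    {A : Type*} [Field A] [TopologicalSpace A] {M : Type*} [AddCommGroup M] [Module A M]
    [TopologicalSpace M] {N : Type*} [AddCommGroup N] [Module A N] [TopologicalSpace N]
    {ρ₁ : ContinuousRep G A M} {ρ₂ : ContinuousRep G A N} (e : ContinuousRep.Equiv ρ₁ ρ₂) :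
    ρ₁.IsIrreducible ↔ ρ₂.IsIrreducible := by
  constructor
  · intro h
    haveI : ρ₁.toRepresentation.IsIrreducible := h
    exact Literature.RepresentationTheory.Semisimple.Representation.isIrreducible_of_equiv
      e.toRepEquiv
  · intro h
    haveI : ρ₂.toRepresentation.IsIrreducible := h
    exact Literature.RepresentationTheory.Semisimple.Representation.isIrreducible_of_equiv
      e.symm.toRepEquiv

/-- **Tower step.**  For a framed Galois representation `ρ : Γ_F → GL_n(k)` and a tower of fields
`F ⊆ E ⊆ L`, the iterated restriction `(ρ|_{Γ_E})|_{Γ_L}` is irreducible if and only if the direct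
restriction `ρ|_{Γ_L}` is: the two are equivalent continuous representations of `Γ_L`
(`SorensenPatching.nonempty_equiv_restrictField_restrictField` — the restriction maps
`Γ_L → Γ_E → Γ_F` and `Γ_L → Γ_F` differ by an inner automorphism of `Γ_F`; Milne, *Fields and
Galois Theory*, Ch. 7), and irreducibility is invariant under equivalence. [folklore] -/
theorem isIrreducible_restrictField_restrictField_iff {F E L : Type*} [Field F] [Field E]
    [Field L] [Algebra F E] [Algebra E L] [Algebra F L] [IsScalarTower F E L] {k : Type*}
    [Field k] [TopologicalSpace k] [IsTopologicalRing k] {n : ℕ} (ρ : FramedGaloisRep F k n) :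
    ((ρ.restrictField E).restrictField L).toGaloisRep.IsIrreducible ↔
      (ρ.restrictField L).toGaloisRep.IsIrreducible := by
  obtain ⟨e⟩ := SorensenPatching.nonempty_equiv_restrictField_restrictField F E L ρ
  exact (ContinuousRep.isIrreducible_iff_of_equiv e).symm

end Summit.Langlands.Langlands.Theorems.IrreducibleOffSector

end
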